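import Summits.CriticalPhenomena.PercolationContinuityZ3.Theorems.PercNearOneGluingNoHeavyQuantAtomLawOrdered
import HarnessLib

/-!
# QUANT lane R8, T-DEC: THE LIGHT-SLICE CORE `LightSliceCore` — the single explicit statement left of (II) after the selection (census-2 g58;
# census-1 g21's LS programme in the vocabulary of the explicit atoms)

builds on p205010 (kernel theorem, internal audit signed; external expert review pending)

Statement file (`--supports stmt-CriticalPhenomena-4575`), QUANT lane seat prim-quant-census-2 (gen 58), rung R8 of
`run/shared/lean/prim/quant/LADDER.md`.  One `@[conjecture]` definition; standard axioms, no sorries.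

THE SELECTION (file `…QuantConvAtomsAssembly`, `convClosedTAtomsOrd_of_lightSliceCore`).  For an ordered atom pair (binder of `ConvClosedTAtomsOrd`):
if a cheap low is NOT deep (`j < l₁′ + h₂′` or `j < l₂′ + h₁′`) the pair is settled by the trivial side (`…QuantConvAtomsTrivialSide`); otherwise
the two LOWEST HEAD CELLS `l₁′ + h₂′`, `l₂′ + h₁′` cannot both be conv-lows (`2(l₁′+h₂′) + 2(l₂′+h₁′) < 2(T₁+T₂) < 2(l₁′+h₁′) + 2(l₂′+h₂′)` by the
compatibilities — census-1 g21 §3 (b)), and a side whose lowest head cell is not a conv-low ("¬A2") and whose light segment is the SHORTER one exists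
(if only one side is ¬A2 its segment is automatically shorter: `l₂′ + h₁′ < l₁′ + h₂′`); by symmetry (`lconv_comm`) it is side 1.  What remains is:

* `LawDec.LightSliceCore` (`@[conjecture]`): in the binder of `ConvClosedTAtomsOrd`, under DOUBLY DEEP (`l₁′ + h₂′ ≤ j`, `l₂′ + h₁′ ≤ j`), ¬A2 on
  side 1 (`T₁ + T₂ ≤ 2(l₁′ + h₂′)`) and the span tie-break (`h₁′ − l₁′ ≤ h₂′ − l₂′`, i.e. `h₁′ + l₂′ ≤ h₂′ + l₁′`), the LIGHT SLICE of side 1,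
  `lconv M₁ M₂ (TP[l₁′, h₁′; gateOf x T₁ j l₁′ h₁′]) (atomLaw x T₂ j l₂ h₂ l₂′ h₂′)`, is DEC at `(T₁ + T₂, j)`.  This is census-1 g21/g22's LS-CORE
  (CONV-RESIDUE-G21 §4–§8: a two-row transport problem; Type I ⊗ Type I role patterns LLM/MMG, LLM/LMG, LLM/LLG; crossed Type II adds one column;
  0 / 121 311 at M ≤ 7 (kit j155785), 0 / 90 000 as a pure 5-variable inequality at span ratio ≤ 4, near-tight (min λ* 1.0047)).
  `ConvClosedTAtomsOrd`, hence `ConvClosedT` and (with (III)) `FarTreeRow`, follow from it (`…QuantConvAtomsAssembly`).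

[this work]; nothing here is cited as a published result.  The gluing rows served [cite: KozmaNitzan2024, Conjecture 3 (p. 15)]; product
measure [cite: Grimmett1999, §1.3 p. 10].
-/

noncomputable section

namespace Summit.CriticalPhenomena.PercolationContinuityZ3.Theorems

namespace Quant

open Finset

/-- the two-point law `{lo, hi; g}` (as in `…QuantLawDEC`) -/
local notation3 "TP[" lo ", " hi ", " g ", " h "]" =>
  (g : ℝ) * (if (h : ℕ) = (hi : ℕ) then (1 : ℝ) else 0) + (1 - (g : ℝ)) * (if (h : ℕ) = (lo : ℕ) then (1 : ℝ) else 0)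

namespace LawDec

/-- **CONJECTURE LIGHT-SLICE CORE (census-2 g58's typing of census-1 g21/g22's LS-CORE).**  For a floor `0 < x < 1`, tops `M₁, M₂`, a layer
`j < M₁ + M₂`, and ORDERED admissible atom data on both sides (`AtomData`, `l < l′`, `h′ ≤ h`), both atoms window-DEC and without a datum free of
light straddlers, in the DOUBLY DEEP configuration (`l₁′ + h₂′ ≤ j`, `l₂′ + h₁′ ≤ j`) with the lowest head cell of side 1 NOT a conv-low
(`T₁ + T₂ ≤ 2(l₁′ + h₂′)`) and side 1's light segment the shorter one (`h₁′ + l₂′ ≤ h₂′ + l₁′`): the light slice of side 1 is DEC at `(T₁ + T₂, j)`.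
EVIDENCE: census-1 g21 kit j154424 / j155785 (LS in the core regime 121 311 / 0; with the span tie-break 0 exceptions at every geometry incl.
supports ≤ 130), census-2 g56 / lead g26 (the whole residue conv-DEC, > 10⁵ pairs / 0); LITERAL TEST of this binder (census-2 g58,
`code/lscore_literal.py`, exact LP; M ≤ 5, ½- and ¼-grid targets, 7 floors): 56 940 ordered window-DEC non-BDEC atom pairs / 0 conv failures,
26 503 instances of this sub-binder / 0 light-slice failures (kit j160465: M ≤ 7, 12 floors).  CAUTION: near-tight (λ* down to 1.0047); false
without the span condition at span ratio ≳ 6 (census-1 §8).  [this work] [status: open] -/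
@[conjecture] def LightSliceCore : Prop :=
  ∀ (x T₁ T₂ : ℝ) (M₁ M₂ j : ℕ) (l₁ h₁ l₁' h₁' l₂ h₂ l₂' h₂' : ℕ),
    0 < x → x < 1 → j < M₁ + M₂ →
    AtomData x T₁ j M₁ l₁ h₁ l₁' h₁' → AtomData x T₂ j M₂ l₂ h₂ l₂' h₂' →
    l₁ < l₁' → h₁' ≤ h₁ → l₂ < l₂' → h₂' ≤ h₂ →
    (∀ j'', j'' ≤ j → j ≤ j'' + M₂ → DECAtT x T₁ j'' M₁ (atomLaw x T₁ j l₁ h₁ l₁' h₁')) →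
    (∀ j'', j'' ≤ j → j ≤ j'' + M₁ → DECAtT x T₂ j'' M₂ (atomLaw x T₂ j l₂ h₂ l₂' h₂')) →
    ¬ BDECAtT x T₁ j M₁ M₂ (atomLaw x T₁ j l₁ h₁ l₁' h₁') → ¬ BDECAtT x T₂ j M₂ M₁ (atomLaw x T₂ j l₂ h₂ l₂' h₂') →
    l₁' + h₂' ≤ j → l₂' + h₁' ≤ j →
    T₁ + T₂ ≤ 2 * ((l₁' : ℝ) + h₂') →
    h₁' + l₂' ≤ h₂' + l₁' →
    DECAtT x (T₁ + T₂) j (M₁ + M₂)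
      (lconv M₁ M₂ (fun b => TP[l₁', h₁', gateOf x T₁ j l₁' h₁', b]) (atomLaw x T₂ j l₂ h₂ l₂' h₂'))

end LawDec

end Quant

end Summit.CriticalPhenomena.PercolationContinuityZ3.Theorems
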